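import Summits.QuantumFields.YangMills.Theorems.SmallCircleAnchorAnchorGapDefectsDilute
import Summits.QuantumFields.YangMills.Theorems.SmallCircleAnchorAnchorGapStaticGaugeEx
import Summits.QuantumFields.YangMills.Theorems.SmallCircleAnchorAnchorGapAbelianisationToolkit

/-!
# Holonomy defects are dilute — expectation form (crux `AnchorGap`)

Helper for crux stmt-QuantumFields-11141 (`AnchorGap`, route `SmallCircleAnchor`), line
independent: `holonomy_defects_dilute_Ex` (registered sub-goal) — in the crux's own functional
(pinning strength a free real `s`), for every measurable conjugation-invariant defect region
`D ⊆ G` and finite set `K` of spatial sites,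
`Ex (∏_{x∈K} 1_D(P_x)) ≤ (e^{12N|β|} ρ_s(D))^{|K|}`, `ρ_s(D) = ∫_D e^{-sV} / ∫ e^{-sV}` (Haar).
Proof: the observable is gauge invariant (the Polyakov line is conjugated, `prod_ofFn_telescope`)
and measurable, so `static_gauge_Ex` (p152839) computes `Ex` in the static gauge, where the
Polyakov line is the top-layer link (`Toolkit.polyakov_kill`, p153727) and
`Defects.holonomy_defects_dilute` bounds the numerator by the constant times the denominator.
-/

set_option autoImplicit false

noncomputable section

namespace Summit.QuantumFields.YangMills.Theorems.AnchorGap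

open MeasureTheory
open Literature.MathematicalPhysics.QuantumFieldTheory

namespace Defects

/-- **Holonomy defects are dilute (expectation form; registered sub-goal of crux `AnchorGap`).**
For measurable conjugation-invariant `D ⊆ G` and a finite set `K` of spatial sites,
`Ex (∏_{x ∈ K} 1_D(P_x U)) ≤ (e^{12 N |β|} ρ_s(D))^{|K|}`. [folklore] -/
theorem holonomy_defects_dilute_Ex :
    ∀ (G : Type) [Group G] [TopologicalSpace G] [IsTopologicalGroup G] [CompactSpace G], letI : MeasurableSpace G := borel G; haveI : BorelSpace G := ⟨rfl⟩; ∀ (r : LatticeRep G) (V : G → ℝ), (∀ a g : G, V (a * g * a⁻¹) = V g) → Continuous V → ∀ (T : ℕ) [NeZero T] (β s : ℝ) (L : ℕ) [NeZero L], let St := ZMod T × (Fin 3 → ZMod L); let Cfg := St × Option (Fin 3) → G; let ν : MeasureTheory.Measure Cfg := MeasureTheory.Measure.pi fun _ => haarProbability G; let sh : St → Option (Fin 3) → St := fun x μ => Option.elim μ (x.1 + 1, x.2) fun i => (x.1, x.2 + Pi.single i 1); let pl : Cfg → St → Option (Fin 3) → Option (Fin 3) → G := fun U x μ κ => U (x,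 μ) * U (sh x μ, κ) * (U (sh x κ, μ))⁻¹ * (U (x, κ))⁻¹; let act : Cfg → ℝ := fun U => β * ∑ x : St, ∑ i : Fin 3, (r.ρ (pl U x none (some i))).trace.re + β * ∑ x : St, ∑ q : {q : Fin 3 × Fin 3 // q.1 < q.2}, (r.ρ (pl U x (some q.1.1) (some q.1.2))).trace.re; let P : Cfg → (Fin 3 → ZMod L) → G := fun U x => (List.ofFn fun t : Fin T => U ((((t : ℕ) : ZMod T), x), none)).prod; let wgt : Cfg → ℝ := fun U => Real.exp (act U - s * ∑ x : Fin 3 → ZMod L, V (P U x)); let Ex : (Cfg → ℝ) → ℝ := fun F => (∫ U, F U * wgt U ∂ν) / (∫ U, wgt U ∂ν); ∀ (D : Set G), MeasurableSet D → (∀ a g : G, a * g * a⁻¹ ∈ D ↔ g ∈ D) → ∀ (K : Finset (Fin 3 → ZMod L)), Ex (fun U => ∏ x ∈ K, D.indicator (fun _ => (1 : ℝ)) (P U x)) ≤ (Real.exp (12 * r.N * |β|) * ((∫ g in D, Real.exp (-(s * V g)) ∂haarProbability G) / (∫ g, Real.exp (-(s * V g)) ∂haarProbability G))) ^ K.card :=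 by
  intro G _ _ _ _
  letI : MeasurableSpace G := borel G
  haveI : BorelSpace G := ⟨rfl⟩
  intro r V hVcl hVc T _ β s L _ St Cfg ν sh pl act P wgt Ex D hD hDconj K
  haveI : SecondCountableTopology G :=
    (r.continuous.isClosedEmbedding r.injective).isEmbedding.secondCountableTopology
  haveI hν : IsProbabilityMeasure ν := by
    show IsProbabilityMeasure (Measure.pi fun _ : St × Option (Fin 3) => haarProbability G)
    infer_instance
  let gauge : (St → G) → Cfg → Cfg := fun h U p => h p.1 * U p * (h (sh p.1 p.2))⁻¹
  let kill : Cfg → Cfg := fun U p => if p.2 = none ∧ p.1.1 + 1 ≠ 0 then 1 else U p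
  let F : Cfg → ℝ := fun U => ∏ x ∈ K, D.indicator (fun _ => (1 : ℝ)) (P U x)
  -- the observable: measurable and gauge invariant
  have hPc : ∀ x : Fin 3 → ZMod L, Continuous fun U : Cfg => P U x := by
    intro x
    show Continuous fun U : Cfg => (List.ofFn fun t : Fin T => U ((((t : ℕ) : ZMod T), x), none)).prod
    simp only [List.ofFn_eq_map]
    exact continuous_list_prod _ fun t _ => continuous_apply _
  have hFm : Measurable F :=
    Finset.measurable_prod _ fun x _ => (measurable_const.indicator hD).comp (hPc x).measurable
  have hP : ∀ (h : St → G) (U : Cfg) (x : Fin 3 → ZMod L),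
      P (gauge h U) x = h (0, x) * P U x * (h (0, x))⁻¹ := by
    intro h U x
    set a : ℕ → G := fun t => h (((t : ℕ) : ZMod T), x) with ha
    have hfun : (fun t : Fin T => gauge h U ((((t : ℕ) : ZMod T), x), none)) =
        fun t : Fin T => a t * U ((((t : ℕ) : ZMod T), x), none) * (a ((t : ℕ) + 1))⁻¹ := by
      funext t
      simp only [ha, Nat.cast_succ]
      rfl
    have h0 : a 0 = h (0, x) := by simp [ha]
    have hT : a T = h (0, x) := by simp [ha]
    show (List.ofFn fun t : Fin T => gauge h U ((((t : ℕ) : ZMod T), x), none)).prod =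
      h (0, x) * (List.ofFn fun t : Fin T => U ((((t : ℕ) : ZMod T), x), none)).prod * (h (0, x))⁻¹
    rw [hfun, GaugeAvg.prod_ofFn_telescope T a, h0, hT]
  have hFg : ∀ (h : St → G) (U : Cfg), F (gauge h U) = F U := by
    intro h U
    show ∏ x ∈ K, D.indicator (fun _ => (1 : ℝ)) (P (gauge h U) x) =
      ∏ x ∈ K, D.indicator (fun _ => (1 : ℝ)) (P U x)
    refine Finset.prod_congr rfl fun x _ => ?_
    rw [hP]
    by_cases hx : P U x ∈ D
    · rw [Set.indicator_of_mem hx, Set.indicator_of_mem ((hDconj _ _).2 hx)]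
    · rw [Set.indicator_of_notMem hx,
        Set.indicator_of_notMem (fun hm => hx ((hDconj _ _).1 hm))]
  -- static gauge
  have hstat : Ex F = (∫ U, F (kill U) * wgt (kill U) ∂ν) / (∫ U, wgt (kill U) ∂ν) :=
    StaticGauge.static_gauge_Ex G r V hVcl hVc T β s L F hFm hFg
  have hnum : ∀ U : Cfg, F (kill U) =
      ∏ x ∈ K, D.indicator (fun _ => (1 : ℝ)) (U (((-1 : ZMod T), x), none)) := by
    intro U
    show ∏ x ∈ K, D.indicator (fun _ => (1 : ℝ)) (P (kill U) x) = _
    refine Finset.prod_congr rfl fun x _ => ?_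
    have hpk : P (kill U) x = U (((-1 : ZMod T), x), none) := Toolkit.polyakov_kill G T L U x
    rw [hpk]
  have hbound : ∫ U, (∏ x ∈ K, D.indicator (fun _ => (1 : ℝ)) (U (((-1 : ZMod T), x), none))) *
      wgt (kill U) ∂ν ≤ (Real.exp (12 * r.N * |β|) * ((∫ g in D, Real.exp (-(s * V g))
        ∂haarProbability G) / (∫ g, Real.exp (-(s * V g)) ∂haarProbability G))) ^ K.card *
      ∫ U, wgt (kill U) ∂ν :=
    holonomy_defects_dilute G r V hVc T β s L D hD K
  -- positivity of the static-gauge partition function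
  have hkc : Continuous kill := by
    refine continuous_pi fun q => ?_
    by_cases hq : q.2 = none ∧ q.1.1 + 1 ≠ 0
    · simp only [kill, if_pos hq]; exact continuous_const
    · simp only [kill, if_neg hq]; exact continuous_apply q
  have hplc : ∀ (x : St) (μ κ : Option (Fin 3)), Continuous fun U : Cfg => pl U x μ κ := by
    intro x μ κ
    show Continuous fun U : Cfg => U (x, μ) * U (sh x μ, κ) * (U (sh x κ, μ))⁻¹ * (U (x, κ))⁻¹
    exact (((continuous_apply (x, μ)).mul (continuous_apply (sh x μ, κ))).mul
      (continuous_apply (sh x κ, μ)).inv).mul (continuous_apply (x, κ)).inv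
  have htrc : ∀ (x : St) (μ κ : Option (Fin 3)),
      Continuous fun U : Cfg => (r.ρ (pl U x μ κ)).trace.re := fun x μ κ =>
    Complex.continuous_re.comp ((r.continuous.comp (hplc x μ κ)).matrix_trace)
  have hactc : Continuous act := by
    refine (continuous_const.mul (continuous_finsetSum _ fun x _ =>
      continuous_finsetSum _ fun i _ => htrc x none (some i))).add
      (continuous_const.mul (continuous_finsetSum _ fun x _ =>
        continuous_finsetSum _ fun q _ => htrc x (some q.1.1) (some q.1.2)))
  have hwc : Continuous wgt :=
    Real.continuous_exp.comp (hactc.sub (continuous_const.mul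
      (continuous_finsetSum _ fun x _ => hVc.comp (hPc x))))
  have hwkc : Continuous fun U : Cfg => wgt (kill U) := hwc.comp hkc
  obtain ⟨U₀, -, hU₀⟩ := isCompact_univ.exists_isMinOn Set.univ_nonempty hwkc.continuousOn
  obtain ⟨U₁, -, hU₁⟩ := isCompact_univ.exists_isMaxOn Set.univ_nonempty hwkc.continuousOn
  have hZ : 0 < ∫ U, wgt (kill U) ∂ν :=
    (Real.exp_pos _).trans_le (le_integral_weight ν hwkc.measurable
      (fun U => hU₀ (Set.mem_univ U)) (fun U => hU₁ (Set.mem_univ U)))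
  -- conclusion
  rw [hstat, div_le_iff₀ hZ]
  calc ∫ U, F (kill U) * wgt (kill U) ∂ν
      = ∫ U, (∏ x ∈ K, D.indicator (fun _ => (1 : ℝ)) (U (((-1 : ZMod T), x), none))) *
          wgt (kill U) ∂ν := by simp only [hnum]
    _ ≤ _ := hbound

end Defects

end Summit.QuantumFields.YangMills.Theorems.AnchorGap

end
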